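import Summits.ResolutionOfSingularities.ResolutionOfSingularities.Theorems.RisoCentresResolve.Negative.RisoCentresResolveFalseOfCollapsedTopLoop
import Summits.ResolutionOfSingularities.ResolutionOfSingularities.Theorems.RisoCentresResolve.Negative.RisoCentresResolveBddLettersRtd
import Summits.ResolutionOfSingularities.ResolutionOfSingularities.Theorems.RisoStrataRisoCentresResolvePCuspNotRegular
import Summits.ResolutionOfSingularities.ResolutionOfSingularities.Theorems.RisoStrataRisoCentresResolveCurveLU
import Summits.ResolutionOfSingularities.ResolutionOfSingularities.Theorems.RisoStrataRisoCentresResolveReduction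

/-!
# Crux `RisoCentresResolve` (stmt-ResolutionOfSingularities-18546) — the construction `CollapsedTopLoop`
# of `RisoCentresResolveFalseOfCollapsedTopLoop.lean` is UNSATISFIABLE

Lead c3 (line `Sketch`). `CollapsedTopLoop` (lead c2) asks for a presentation `K = k(hᵢ/hⱼ)` over an
algebraically closed `k` of characteristic `p` with
(COLLAPSE) `¬ Rtd B m 1` at every singular maximal ideal `m` of EVERY `k`-subalgebra `B ⊆ K`, and
(LOOP) for every `L` an admissible `0^L`-tower along some valuation ring ending non-regular.
We prove `not_CollapsedTopLoop : ¬ CollapsedTopLoop`: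
* if `Algebra.trdeg k K ≤ 1` (points and curves), the curve uniformization `rcr_localUnif_curve`
  (lead c1) and the Zariski–Riemann transfer `stub_rcrTransfer` give a finite schedule resolving the
  presentation along every valuation; under COLLAPSE every schedule of length `L` defines the same tower
  as `0^L` (`risoStage_eq_of_collapse`), contradicting LOOP at that `L`;
* otherwise `K` contains an algebraically independent pair `(T, u)` (`cuspLine_exists_pair`), hence the
  chart `B₀ = k[T², T³, u]` (cusp × line). Its maximal ideal `m = (T², T³, u)` is SINGULAR
  (`cuspLine_exists_singular_rtd_one`: a regular local ring is integrally closed, so `T = T³/T²` would be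
  `a/s` with `a, s ∈ B₀`, `s ∉ m`; pulling back to `k[X₀, X₁]` along the algebraically independent pair,
  `X₀·S ∈ k[X₀², X₀³, X₁]` forces — via the derivation `Q ↦ (∂Q/∂X₀)(0, X₁)`, which kills that
  subalgebra — `S(0, X₁) = 0`, i.e. `s ∈ m`), while `Rtd B₀ m 1` HOLDS (`bddLetters_rtd`, refuter g2:
  cusp × 𝔸¹ is riso-trivial along the line) — contradicting COLLAPSE.
So lead c2's negative lemma `RisoCentresResolve_false_of_CollapsedTopLoop` is vacuous; its honest
replacement is `RisoCentresResolve_false_of_CollapsedTowerLoop` (collapse only along the looping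
tower's own stages). Kernel-only; no definitions.
-/

noncomputable section

set_option linter.dupNamespace false -- mandated namespace of this single-conjunct summit

namespace Summit.ResolutionOfSingularities.ResolutionOfSingularities.Theorems

open Summit.ResolutionOfSingularities.ResolutionOfSingularities.Theses.RisoStrata
open Literature.AlgebraicGeometry.Resolution

section CuspLine

variable {k K : Type} [Field k] [Field K] [Algebra k K]

/-- **Transcendence degree `> 1` gives an algebraically independent pair.** [folklore] -/
theorem cuspLine_exists_pair (h : ¬ Algebra.trdeg k K ≤ 1) :
    ∃ s : Fin 2 → K, AlgebraicIndependent k s := by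
  by_contra hne
  push Not at hne
  apply h
  rw [Algebra.trdeg]
  refine ciSup_le' fun ι => ?_
  refine Cardinal.mk_le_one_iff_set_subsingleton.mpr fun a ha b hb => ?_
  by_contra hab
  let f : Fin 2 → ι.1 := ![⟨a, ha⟩, ⟨b, hb⟩]
  have hf : Function.Injective f := by
    intro i j hij
    fin_cases i <;> fin_cases j
    · rfl
    · exact absurd (congrArg Subtype.val hij) hab
    · exact absurd (congrArg Subtype.val hij).symm hab
    · rfl
  exact hne _ (ι.2.comp f hf)

/-- **The derivation killing `k[X₀², X₀³, X₁]`.** For `Q` in the subalgebra of `k[X₀, X₁]` generated by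
`X₀², X₀³, X₁`, the polynomial `(∂Q/∂X₀)(0, X₁)` vanishes (Leibniz: the kernel of
`Q ↦ (∂Q/∂X₀)(0, X₁)` is a subalgebra containing the three generators). [folklore] -/
theorem cuspLine_deriv_eq_zero (Q : MvPolynomial (Fin 2) k)
    (hQ : Q ∈ Algebra.adjoin k ({MvPolynomial.X 0 ^ 2, MvPolynomial.X 0 ^ 3, MvPolynomial.X 1} :
      Set (MvPolynomial (Fin 2) k))) :
    MvPolynomial.aeval (![0, MvPolynomial.X 1] : Fin 2 → MvPolynomial (Fin 2) k)
      (MvPolynomial.pderiv 0 Q) = 0 := by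
  set ev : MvPolynomial (Fin 2) k →ₐ[k] MvPolynomial (Fin 2) k :=
    MvPolynomial.aeval (![0, MvPolynomial.X 1] : Fin 2 → MvPolynomial (Fin 2) k) with hev
  -- the kernel of `Q ↦ ev (∂₀ Q)` is a subalgebra
  let L : Subalgebra k (MvPolynomial (Fin 2) k) :=
    { carrier := {Q | ev (MvPolynomial.pderiv 0 Q) = 0}
      mul_mem' := by
        intro a b ha hb
        simp only [Set.mem_setOf_eq] at ha hb ⊢
        rw [(MvPolynomial.pderiv 0).leibniz, smul_eq_mul, smul_eq_mul, map_add, map_mul, map_mul, ha,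
          hb, mul_zero, mul_zero, add_zero]
      add_mem' := by
        intro a b ha hb
        simp only [Set.mem_setOf_eq] at ha hb ⊢
        rw [map_add, map_add, ha, hb, add_zero]
      algebraMap_mem' := fun c => by
        simp only [Set.mem_setOf_eq]
        rw [MvPolynomial.algebraMap_eq, MvPolynomial.pderiv_C, map_zero] }
  have hle : Algebra.adjoin k ({MvPolynomial.X 0 ^ 2, MvPolynomial.X 0 ^ 3, MvPolynomial.X 1} :
      Set (MvPolynomial (Fin 2) k)) ≤ L := by
    refine Algebra.adjoin_le ?_
    rintro Q (rfl | rfl | rfl)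
    · show ev (MvPolynomial.pderiv 0 (MvPolynomial.X 0 ^ 2)) = 0
      rw [(MvPolynomial.pderiv 0).leibniz_pow, MvPolynomial.pderiv_X]
      simp [hev]
    · show ev (MvPolynomial.pderiv 0 (MvPolynomial.X 0 ^ 3)) = 0
      rw [(MvPolynomial.pderiv 0).leibniz_pow, MvPolynomial.pderiv_X]
      simp [hev]
    · show ev (MvPolynomial.pderiv 0 (MvPolynomial.X 1)) = 0
      rw [MvPolynomial.pderiv_X]
      simp
  exact hle hQ

/-- **Cusp × line is singular along the line, and riso-trivial there.** For an algebraically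
independent pair `s = (T, u)` in `K ⊇ k` (`k` algebraically closed) the chart
`B₀ = k[T², T³, u]` has a maximal ideal `m` (the point `T = u = 0`) such that `(B₀)_m` is NOT regular
while the crux's inline `Rtd B₀ m 1` holds (`bddLetters_rtd`). [folklore] -/
theorem cuspLine_exists_singular_rtd_one [IsAlgClosed k] (s : Fin 2 → K)
    (hs : AlgebraicIndependent k s) :
    ∃ (B₀ : Subalgebra k K) (m : Ideal ↥B₀) (hm : m.IsMaximal),
      ¬ IsRegularLocalRing (Localization (@Ideal.primeCompl ↥B₀ _ m hm.isPrime)) ∧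
      ∃ (n : ℕ) (g : Fin n → ↥B₀), (∀ i, g i ∈ m) ∧ Algebra.adjoin k (Set.range fun i => (g i : K)) = B₀ ∧
      ∃ W : Submodule k (Fin n → k), 1 ≤ Module.finrank k ↥W ∧
      ∃ φ : {α : ↥B₀ →ₐ[k] HahnSeries ℚ k // ∀ b ∈ m, 0 < (α b).orderTop} → (Fin n → HahnSeries ℚ k),
        (∀ a b : {α : ↥B₀ →ₐ[k] HahnSeries ℚ k // ∀ b ∈ m, 0 < (α b).orderTop}, a ≠ b →
          ∃ j, ∀ i, (a.1 (g j) - b.1 (g j)).orderTop < ((φ a i - φ b i) - (a.1 (g i) - b.1 (g i))).orderTop) ∧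
        (∀ a i, 0 < (φ a i).orderTop) ∧
        (∀ a, ∀ w : Fin n → HahnSeries ℚ k, (∀ i, 0 < (w i).orderTop) →
          w ∈ Submodule.span (HahnSeries ℚ k)
            ((fun u : Fin n → k => fun i => HahnSeries.C (u i)) '' (W : Set (Fin n → k))) →
          ∃ b, φ b = φ a + w) := by
  classical
  set T : K := s 0 with hT
  set z : Fin 1 → K := fun _ => s 1 with hz
  have hcons : (Fin.cons T z : Fin 2 → K) = s := by
    funext i
    refine Fin.cases ?_ (fun j => ?_) i
    · rfl
    · rw [Fin.cons_succ, hz]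
      have hj : j = 0 := Subsingleton.elim _ _
      subst hj
      rfl
  have hinj : Function.Injective
      (MvPolynomial.aeval (Fin.cons T z : Fin 2 → K) : MvPolynomial (Fin 2) k →ₐ[k] K) := by
    rw [hcons]; exact algebraicIndependent_iff_injective_aeval.mp hs
  set f : MvPolynomial (Fin 2) k →ₐ[k] K := MvPolynomial.aeval s with hf
  have hfinj : Function.Injective f := algebraicIndependent_iff_injective_aeval.mp hs
  have hfX0 : f (MvPolynomial.X 0) = T := by rw [hf, MvPolynomial.aeval_X]
  have hfX1 : f (MvPolynomial.X 1) = s 1 := by rw [hf, MvPolynomial.aeval_X]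
  -- the chart and its polynomial model
  set B₀ : Subalgebra k K := Algebra.adjoin k (insert (T ^ 2) (insert (T ^ 3) (Set.range z))) with hB₀
  set R₀ : Subalgebra k (MvPolynomial (Fin 2) k) :=
    Algebra.adjoin k ({MvPolynomial.X 0 ^ 2, MvPolynomial.X 0 ^ 3, MvPolynomial.X 1} :
      Set (MvPolynomial (Fin 2) k)) with hR₀
  have hmap : B₀ = R₀.map f := by
    rw [hR₀, AlgHom.map_adjoin, hB₀]
    congr 1
    ext y
    simp only [Set.mem_insert_iff, Set.mem_range, Set.mem_image, hz]
    constructor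
    · rintro (rfl | rfl | ⟨_, rfl⟩)
      · exact ⟨_, Or.inl rfl, by rw [map_pow, hfX0]⟩
      · exact ⟨_, Or.inr (Or.inl rfl), by rw [map_pow, hfX0]⟩
      · exact ⟨_, Or.inr (Or.inr rfl), hfX1⟩
    · rintro ⟨Q, hQ, rfl⟩
      rcases hQ with rfl | rfl | rfl
      · exact Or.inl (by rw [map_pow, hfX0])
      · exact Or.inr (Or.inl (by rw [map_pow, hfX0]))
      · exact Or.inr (Or.inr ⟨0, hfX1.symm⟩)
  have hmemB : ∀ {y : K}, y ∈ B₀ ↔ ∃ Q ∈ R₀, f Q = y := fun {y} => by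
    rw [hmap]; exact Subalgebra.mem_map
  -- the character "evaluation at `T = u = 0`" and its kernel `m`
  have hle : B₀ ≤ f.range := by
    rw [hmap]; exact Subalgebra.map_le.mpr fun Q _ => ⟨Q, rfl⟩
  set e := AlgEquiv.ofInjective f hfinj with he
  set ε : ↥B₀ →ₐ[k] k :=
    (MvPolynomial.aeval (0 : Fin 2 → k)).comp (e.symm.toAlgHom.comp (Subalgebra.inclusion hle))
    with hε
  have hεf : ∀ (Q : MvPolynomial (Fin 2) k) (hQ : f Q ∈ B₀),
      ε ⟨f Q, hQ⟩ = MvPolynomial.aeval (0 : Fin 2 → k) Q := by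
    intro Q hQ
    have h1 : e.symm (Subalgebra.inclusion hle ⟨f Q, hQ⟩) = Q := by
      rw [AlgEquiv.symm_apply_eq]
      apply Subtype.ext
      rw [AlgEquiv.ofInjective_apply]
      rfl
    change MvPolynomial.aeval (0 : Fin 2 → k) (e.symm (Subalgebra.inclusion hle ⟨f Q, hQ⟩)) = _
    rw [h1]
  have hεsurj : Function.Surjective ε := fun c => ⟨algebraMap k ↥B₀ c, by rw [AlgHom.commutes]; rfl⟩
  set m : Ideal ↥B₀ := RingHom.ker ε.toRingHom with hmdef
  have hm : m.IsMaximal := RingHom.ker_isMaximal_of_surjective ε.toRingHom hεsurj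
  have hmem_m : ∀ b : ↥B₀, b ∈ m ↔ ε b = 0 := fun b => RingHom.mem_ker
  -- elements
  have hT2 : T ^ 2 ∈ B₀ := by rw [hB₀]; exact Algebra.subset_adjoin (Set.mem_insert _ _)
  have hT3 : T ^ 3 ∈ B₀ := by
    rw [hB₀]; exact Algebra.subset_adjoin (Set.mem_insert_of_mem _ (Set.mem_insert _ _))
  have hT0 : T ≠ 0 := by
    intro h0
    apply MvPolynomial.X_ne_zero (R := k) (0 : Fin 2)
    apply hfinj
    rw [hfX0, h0, map_zero]
  refine ⟨B₀, m, hm, ?_, bddLetters_rtd T z hinj B₀ hB₀ m hm 1 le_rfl⟩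
  -- SINGULARITY: a regular `(B₀)_m` is integrally closed, so `T = T³/T² = a/s`, `s ∉ m`
  intro hreg
  haveI := hm.isPrime
  haveI : IsRegularLocalRing (Localization.AtPrime m) := hreg
  have hrelB : (⟨T ^ 3, hT3⟩ : ↥B₀) ^ 2 = ⟨T ^ 2, hT2⟩ * (⟨T ^ 2, hT2⟩ : ↥B₀) ^ 2 := by
    apply Subtype.ext
    simp only [SubmonoidClass.mk_pow, MulMemClass.coe_mul]
    ring
  have hP10 : (⟨T ^ 2, hT2⟩ : ↥B₀) ≠ 0 := fun h => pow_ne_zero 2 hT0 (congrArg Subtype.val h)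
  obtain ⟨a, sM, hrel⟩ := pcn_exists_of_isRegularLocalRing (B := ↥B₀) (L := Localization.AtPrime m)
    m.primeCompl (Ideal.primeCompl_le_nonZeroDivisors m) (n := 2) two_pos
    ⟨T ^ 2, hT2⟩ ⟨T ^ 2, hT2⟩ ⟨T ^ 3, hT3⟩ hrelB hP10
  have hrelK : (a : K) * T ^ 2 = T ^ 3 * ((sM : ↥B₀) : K) := congrArg Subtype.val hrel
  have haK : (a : K) = T * ((sM : ↥B₀) : K) := by
    have h2 : T ^ 2 ≠ 0 := pow_ne_zero 2 hT0
    apply mul_right_cancel₀ h2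
    rw [hrelK]; ring
  -- pull back to polynomials
  obtain ⟨A, hA, hfA⟩ := hmemB.mp a.2
  obtain ⟨S, hS, hfS⟩ := hmemB.mp (sM : ↥B₀).2
  have hAS : A = MvPolynomial.X 0 * S := by
    apply hfinj
    rw [map_mul, hfX0, hfS, hfA]
    exact haK
  have hX0S : MvPolynomial.X 0 * S ∈ R₀ := hAS ▸ hA
  -- the derivation argument: `S(0, X₁) = 0`
  have hd := cuspLine_deriv_eq_zero _ hX0S
  rw [(MvPolynomial.pderiv 0).leibniz, smul_eq_mul, smul_eq_mul, map_add, map_mul, map_mul,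
    cuspLine_deriv_eq_zero _ hS, mul_zero, zero_add, MvPolynomial.pderiv_X] at hd
  simp only [Pi.single_eq_same, map_one, mul_one] at hd
  -- hence `ε s = S(0,0) = 0`, i.e. `s ∈ m`: contradiction
  have hev0 : MvPolynomial.aeval (0 : Fin 2 → k) S = 0 := by
    have hcomp : (MvPolynomial.aeval (0 : Fin 2 → k)).comp
        (MvPolynomial.aeval (![0, MvPolynomial.X 1] : Fin 2 → MvPolynomial (Fin 2) k)) =
        MvPolynomial.aeval (0 : Fin 2 → k) := by
      rw [MvPolynomial.comp_aeval]
      congr 1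
      funext i
      fin_cases i <;> simp
    have := congrArg (fun φ : MvPolynomial (Fin 2) k →ₐ[k] k => φ S) hcomp
    simp only [AlgHom.comp_apply] at this
    rw [← this, hd, map_zero]
  have hsm : (sM : ↥B₀) ∈ m := by
    rw [hmem_m]
    have h := hεf S (hfS ▸ (sM : ↥B₀).2)
    have hsub : (⟨f S, hfS ▸ (sM : ↥B₀).2⟩ : ↥B₀) = (sM : ↥B₀) := Subtype.ext hfS
    rw [hsub] at h
    rw [h, hev0]
  exact sM.2 hsm

end CuspLine

/-- **`CollapsedTopLoop` is unsatisfiable.** In transcendence degree `≤ 1` the constant word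
terminates (curve uniformization + Zariski–Riemann transfer, and COLLAPSE makes every schedule act as
the constant word), contradicting LOOP; in transcendence degree `≥ 2` the chart cusp × line inside
`K` has a singular maximal ideal of typed `Rtd ≥ 1` (`cuspLine_exists_singular_rtd_one`),
contradicting COLLAPSE. Hence `RisoCentresResolve_false_of_CollapsedTopLoop` is vacuous (its honest
replacement: `RisoCentresResolve_false_of_CollapsedTowerLoop`). [folklore] -/
theorem not_CollapsedTopLoop : ¬ CollapsedTopLoop := by
  rintro ⟨p, hp, k, _, _, _, K, _, _, N, h, hh, hgen, hcol, hloop⟩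
  by_cases htr : Algebra.trdeg k K ≤ 1
  · -- curves: a resolving schedule exists; under COLLAPSE it acts as the constant word
    set P : ∀ B : Subalgebra k K, Ideal ↥B → ℕ → Prop := (fun (B : Subalgebra k K) (m : Ideal ↥B) (d : ℕ) => ¬ ∃ (n : ℕ) (g : Fin n → ↥B), (∀ i, g i ∈ m) ∧ Algebra.adjoin k (Set.range fun i => (g i : K)) = B ∧ ∃ W : Submodule k (Fin n → k), d + 1 ≤ Module.finrank k ↥W ∧ ∃ φ : {α : ↥B →ₐ[k] HahnSeries ℚ k // ∀ b ∈ m, 0 < (α b).orderTop} → (Fin n → HahnSeries ℚ k), (∀ a b : {α : ↥B →ₐ[k] HahnSeries ℚ k // ∀ b ∈ m, 0 < (α b).orderTop}, a ≠ b → ∃ j, ∀ i, (a.1 (g j) - b.1 (g j)).orderTop < ((φ a i - φ b i) - (a.1 (g i) - b.1 (g i))).orderTop) ∧ (∀ a i, 0 < (φ a i).orderTop) ∧ (∀ a, ∀ w : Fin n → HahnSeries ℚ k, (∀ i, 0 < (w i).orderTop) → w ∈ Submodule.span (HahnSeries ℚ k) ((fun u : Fin n → k => fun i => HahnSeries.C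 (u i)) '' (W : Set (Fin n → k))) → ∃ b, φ b = φ a + w)) with hPdef
    obtain ⟨w, hw⟩ := rcr_localUnif_curve p hp k K N h hh hgen htr
    have hLoc := reduction_risoLocal_cut p hp k K
    obtain ⟨T, hT⟩ := stub_rcrTransfer P N h hh w
      (fun O B hB hBO d xt hV hreg => stub_rcrPersist P O B hB hBO d xt hV hreg)
      (fun O B B' hB hB' hBO hB'O hloc d xt xt' hV hV' =>
        stub_rcrPathIndep P hLoc O B B' hB hB' hBO hB'O hloc
          (stub_rcrRefine O B B' hB hB' hBO hB'O hloc) d xt xt' hV hV')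
      (fun O B hB hBO hreg => stub_rcrRegNbhd O B hB hBO hreg) hw
    -- the schedule `w|T` resolves every valuation; compare with `0^T` under COLLAPSE
    obtain ⟨O, hk, j, hj, x, hvalid, hnreg⟩ := hloop T
    set B₀ : Subalgebra k K := Algebra.adjoin k (Set.range fun i => h i * (h j)⁻¹) with hB₀def
    have hP : ∀ (B : Subalgebra k K) (m : Ideal ↥B) (hm : m.IsMaximal),
        ¬ IsRegularLocalRing (Localization (@Ideal.primeCompl ↥B _ m hm.isPrime)) → ∀ d, P B m d := by
      intro B m hm hreg d
      rintro ⟨n, g, hg, hgen', W, hW, φ, h1, h2, h3⟩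
      exact hcol B m hm hreg ⟨n, g, hg, hgen', W, le_trans (Nat.le_add_left 1 d) hW, φ, h1, h2, h3⟩
    have hlen : ((List.range T).map w).length = T := by simp
    have key : ∀ t, t ≤ T →
        risoStage P B₀ ((List.range T).map w) x t = risoStage P B₀ (List.replicate T 0) x t :=
      fun t ht => risoStage_eq_of_collapse P hP B₀ _ _ x (by rw [hlen]; exact ht)
        (by rw [List.length_replicate]; exact ht)
    apply hnreg
    rw [← key T le_rfl]
    refine hT O hk j hj x fun t ht => ?_
    rw [key t ht.le, risoValid_iff_of_collapse P O _ (hP _) (w t) 0 (x t)]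
    exact hvalid t ht
  · -- transcendence degree ≥ 2: cusp × line contradicts COLLAPSE
    obtain ⟨s, hs⟩ := cuspLine_exists_pair htr
    obtain ⟨B₀, m, hm, hsing, hrtd⟩ := cuspLine_exists_singular_rtd_one s hs
    exact hcol B₀ m hm hsing hrtd

end Summit.ResolutionOfSingularities.ResolutionOfSingularities.Theorems

end
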